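import Literature.Computability.Complexity.CircuitLowerBounds
import Literature.Computability.Complexity.CircuitEval
import Literature.Computability.Complexity.ACRealize
import HarnessLib

/-!
# Williams' programme for `NTIME(2ⁿ) ⊄ ACC⁰`: the printed proof architecture (trunk CplxCore)

This file DECOMPOSES the named fact `Literature.PNP.williams_acc : ¬ (NTIME (2 ^ ·) ⊆ ACC0)`
(`CircuitLowerBounds.lean`; R. Williams, *Nonuniform ACC circuit lower bounds*, J. ACM 61 (2014),
Thm. 1.1) into the two theorems of that paper from which Theorem 1.1 follows, vendored as named
facts over the H21 model, and PROVES the assembly step: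

* `Williams2014_lowerBound_of_accSat` — the *algorithms-to-lower-bounds transfer*
  (Williams 2014, Thm. 1.3, for the circuit class `ACC`): there is a `k > 0` such that if, for
  every depth `d`, modulus `m ≥ 2` and exponent `c`, satisfiability of `n`-input `AC⁰[m]`
  circuits of depth `d` and size `n ^ c` is decidable in `O(2ⁿ / nᵏ)` deterministic time, then
  `NTIME(2ⁿ) ⊄ ACC⁰`;
* `Williams2014_accSat_polysize` — the *ACC satisfiability algorithm* in the polynomial-size
  form used in the proof of Thm. 1.1 (Williams 2014, Thm. 4.1 and p. 18: "the Circuit SAT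
  algorithm of Theorem 4.1 can determine satisfiability of any `n + c log n` input, `n ^ c` size
  ACC circuit in `O(2^{n - log² n})` time, for every constant `c`");
* `williams_acc_of_Williams2014` — **proved**: the two facts imply `williams_acc`
  (for `n ≥ 2 ^ (k + 1)` one has `nᵏ ≤ 2 ^ ((log₂ n)²)`, so `2ⁿ / 2^{(log₂ n)²} ≤ 2ⁿ / nᵏ`; the
  finitely many smaller `n` are absorbed by the additive constant of the time bound);
* two ingredients of the printed proof of Thm. 1.3 that need no further notions:
  `ntime_hierarchy` (the nondeterministic time hierarchy theorem, Arora–Barak 2009, Thm. 3.2,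
  named fact) and `Williams2014_PPoly_subset_ACC0_of_P_subset` (Williams 2014, Lemma 5.1 for
  `ACC`: `P ⊆ ACC0 → P/poly ⊆ ACC0`), the latter **proved**
  (`Williams2014_PPoly_subset_ACC0_of_P_subset_holds`) from `PPoly = P/poly-advice`
  (`CircuitEval.lean`) and a hard-wiring lemma for circuits over any basis with constants
  (`Circuit.exists_hardwire`: size `+ 2`, `acDepth + 1`, via the depth estimate
  `GateList.getD_wdepths_append_reloc_le` for relocated gate lists).

To state the two facts we define: satisfiability of a circuit (`Circuit.Satisfiable`); symbolic
codes for the gates of `accBasis m` (`GateFn.ofAccCode`, `accCode`, with the round trip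
`GateFn.ofAccCode_accCode` on `accBasis m`); the string encoding `encodeAccCircuit m C` of a
circuit over `accBasis m` (a flattened, self-delimiting list of naturals in binary, via
`encodingListNatBool`; injective on circuits over `accBasis m`, `encodeAccCircuit_injOn`); and
the predicate `AccSatInTime d m s T` — "some TM2 machine decides
satisfiability of every `accBasis m`-circuit on `n` inputs of `acDepth ≤ d`, at most `s n` gates
and fan-in at most `s n`, presented as `encodeAccCircuit m C`, within `c * T n + c` steps".

## Faithfulness notes

* Williams measures size by wires (p. 5) and remarks that for circuits with polynomially many
  gates the distinction does not matter; H21's `ACC0` bounds the number of gates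
  (`Circuit.size`). In `AccSatInTime` instances are bounded in gates AND fan-in
  (`Circuit.maxFanIn`), so `n ^ c + c` gates of fan-in `≤ n ^ c + c` means `≤ (n ^ c + c)²`
  wires — polynomial again, and the hypotheses of both facts quantify over every `c`.
* Thm. 1.3 is printed for a generic class `C` with one SAT algorithm per exponent `c`; for
  `C = ACC = ⋃_{d, m} AC⁰_d[m]` the proof (Lemma 3.1, Thm. 3.2, proof of Thm. 1.1 on p. 18) only
  ever runs the SAT algorithm on circuits of depth `2 d₀ + O(1)` over one modulus, where
  `d₀, m₀` come from the assumed circuits for `P`, and p. 18 combines it with the algorithm of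
  Thm. 4.1 whose savings depend on `d` (and `m`). We therefore let the assumed algorithm depend
  on `(d, m, c)`, which is the form the printed proof establishes and uses.
* Time bounds are the arithmetic `O`-form `c * T n + c` of the library (`DTIME`, `NTIME`), with
  `T n = 2 ^ n / n ^ k`, resp. `2 ^ n / 2 ^ (Nat.log 2 n) ^ 2` (natural division; the quotient is
  `0` for the finitely many `n` with `nᵏ > 2ⁿ`, absorbed by `+ c`).
* The machine model of the SAT algorithm is Mathlib's multi-stack `TM2` (two stacks simulate a
  tape), for which Williams' multitape implementation (App. C) applies; p. 5: "the choice of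
  uniform machine model is not crucial".

## The rest of the printed proof (recorded for the further decomposition)

Thm. 1.3 itself rests on: the nondeterministic time hierarchy (Cook 1972,
Seiferas–Fischer–Meyer 1978, Žák 1983; vendored here in Arora–Barak's form, Thm. 3.2, as
`ntime_hierarchy`); the efficient succinct Cook–Levin reduction (Fact 3.1, from Tourlakis 2001 /
Fortnow–Lipton–van Melkebeek–Viglas 2005, Thm. 3.3); universal witness circuits for
`NEXP ⊆ P/poly` (Thm. 5.2, Impagliazzo–Kabanets–Wigderson 2002); the folklore Lemma 5.1 (`P` in
`ACC` gives `ACC` circuits for every polynomial-size circuit family, via CIRCUIT-EVAL; vendored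
and proved here, `Williams2014_PPoly_subset_ACC0_of_P_subset : P ⊆ ACC0 → PPoly ⊆ ACC0`); and
the new
guess-and-verify Lemma 3.1 with the construction of Thm. 3.2. Thm. 4.1 rests on the `SYM⁺`
representation of `ACC` (Lemma 4.1: Yao 1990, Beigel–Tarui 1994, Allender–Gore 1994; App. A)
and the evaluation lemma (Lemma 4.2: Yates' zeta transform / Coppersmith's rectangular matrix
multiplication). Fact 3.1, Thm. 5.2, Lemma 3.1 and Lemmas 4.1–4.2 need further definitions
(succinct 3SAT, witness circuits, `SYM⁺` circuits) and are left to the files that attack the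
two facts above.

## References

* R. Williams, *Nonuniform ACC circuit lower bounds*, J. ACM 61(1) (2014) 2:1–2:32
  (CCC 2011), Thm. 1.1, Thm. 1.3, §2 (machine models, size), Lemma 3.1, Thm. 3.2, Thm. 4.1,
  Lemma 4.1–4.2, Lemma 5.1, Thm. 5.2, proof of Thm. 1.1 (p. 17–18) [Williams2014].
* S. Arora, B. Barak, *Computational Complexity: A Modern Approach*, CUP 2009, §0.1
  (representing circuits as strings), Thm. 3.2 (nondeterministic time hierarchy), Def. 6.1,
  Def. 14.3–14.4 [AroraBarak2009].
* S. Žák, *A Turing machine time hierarchy*, Theoret. Comput. Sci. 26 (1983) 327–333.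
-/

namespace Literature.Computability.Complexity

open _root_.Computability Turing Filter Asymptotics

/-! ### Satisfiability of a circuit -/

/-- A Boolean circuit `C` over the input variables `ι` is *satisfiable* if some assignment
`x : ι → Bool` makes it output `true` (the CIRCUIT-SAT property; Williams 2014, §3:
"is there an assignment of its inputs that makes `C` evaluate to 1?"; Arora–Barak 2009,
Def. 6.1). [cite: Williams2014, §3] -/
def Circuit.Satisfiable {ι : Type*} (C : Circuit ι) : Prop :=
  ∃ x : ι → Bool, C.eval x = true

/-- Satisfiability of a circuit on finitely many input variables is decidable (try all
assignments). [folklore] -/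
instance Circuit.decidableSatisfiable {ι : Type*} [Fintype ι] [DecidableEq ι] (C : Circuit ι) :
    Decidable C.Satisfiable :=
  inferInstanceAs (Decidable (∃ x : ι → Bool, C.eval x = true))

/-- The constant-`true` circuit is satisfiable (any assignment). [folklore] -/
theorem Circuit.satisfiable_const_true (ι : Type*) : (Circuit.const ι true).Satisfiable :=
  ⟨fun _ => false, Circuit.eval_const true _⟩

/-- The constant-`false` circuit is unsatisfiable. [folklore] -/
theorem Circuit.not_satisfiable_const_false (ι : Type*) : ¬ (Circuit.const ι false).Satisfiable :=
  fun ⟨x, hx⟩ => Bool.false_ne_true ((Circuit.eval_const false x).symm.trans hx)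

/-- A circuit computing `f` is satisfiable iff `f` takes the value `true`. [folklore] -/
theorem Circuit.Computes.satisfiable_iff {ι : Type*} {C : Circuit ι} {f : (ι → Bool) → Bool}
    (h : C.Computes f) : C.Satisfiable ↔ ∃ x, f x = true := by
  simp only [Circuit.Satisfiable, h _]

/-! ### Symbolic codes for the gates of `accBasis m` -/

/-- The gate function with symbolic code `code` and arity `k` over the modulus `m`:
`0 ↦ ¬` (arity `1` regardless of `k`), `1 ↦ ∧ₖ`, `2 ↦ ∨ₖ`, `≥ 3 ↦ MODₘ,ₖ`. Every value lies
in `accBasis m` (`GateFn.ofAccCode_mem_accBasis`). This is the gate-type alphabet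
{AND, OR, NOT, MODₘ} of Williams 2014, §2/§3 (Arora–Barak 2009, Def. 14.3). [cite: Williams2014, §2] -/
def GateFn.ofAccCode (m : ℕ) : ℕ → ℕ → GateFn
  | 0, _ => GateFn.not
  | 1, k => GateFn.and k
  | 2, k => GateFn.or k
  | _ + 3, k => GateFn.modGate m k

/-- The symbolic code of a gate function relative to the modulus `m`: `0` for `¬`, `1` for a
conjunction `∧ₖ`, `2` for a disjunction `∨ₖ`, `3` for `MODₘ,ₖ`, and `4` otherwise (tested in
this order, by decidable extensional equality of truth tables; coincidences such as
`∨₀ = MODₘ,₀` are resolved by the first match and do not affect `GateFn.ofAccCode_accCode`).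
(Williams 2014, §3, proof of Lemma 3.1: gates described by "gate type" and input indices.) [cite: Williams2014, §3] -/
def accCode (m : ℕ) (f : GateFn) : ℕ :=
  if f = GateFn.not then 0
  else if f = GateFn.and f.1 then 1
  else if f = GateFn.or f.1 then 2
  else if f = GateFn.modGate m f.1 then 3
  else 4

/-- Decoding a symbolic code always yields a gate of `accBasis m`. [folklore] -/
theorem GateFn.ofAccCode_mem_accBasis (m code k : ℕ) : GateFn.ofAccCode m code k ∈ accBasis m := by
  match code with
  | 0 => exact Or.inl (Or.inl rfl)
  | 1 => exact Or.inl (Or.inr (Set.mem_iUnion.2 ⟨k, Or.inl rfl⟩))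
  | 2 => exact Or.inl (Or.inr (Set.mem_iUnion.2 ⟨k, Or.inr rfl⟩))
  | _ + 3 => exact Or.inr (Set.mem_iUnion.2 ⟨k, rfl⟩)

/-- Round trip: on the basis `accBasis m` the symbolic code together with the arity determines
the gate function, `ofAccCode m (accCode m f) f.1 = f`. Hence `encodeAccCircuit m` loses no
information on circuits over `accBasis m` (`encodeAccCircuit_injOn`). [folklore] -/
theorem GateFn.ofAccCode_accCode {m : ℕ} {f : GateFn} (h : f ∈ accBasis m) :
    GateFn.ofAccCode m (accCode m f) f.1 = f := by
  unfold accCode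
  split_ifs with h0 h1 h2 h3
  · subst h0; rfl
  · rw [h1]; rfl
  · rw [h2]; rfl
  · rw [h3]; rfl
  · exfalso
    simp only [accBasis, acBasis, Set.mem_union, Set.mem_singleton_iff, Set.mem_iUnion,
      Set.mem_insert_iff] at h
    rcases h with (h | ⟨k, h | h⟩) | ⟨k, h⟩
    · exact h0 h
    · exact h1 (by rw [h]; rfl)
    · exact h2 (by rw [h]; rfl)
    · exact h3 (by rw [h]; rfl)

/-! ### String encoding of circuits over `accBasis m` -/

/-- The code of a wire as two naturals: an input variable `i` is `[0, i]`, a back-reference to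
gate `j` is `[1, j]` (a design choice of this file; cf. Williams 2014, §3, proof of Lemma 3.1:
"INPUT" gates versus gate indices; Arora–Barak 2009, §0.1). [folklore] -/
def wireCode {n : ℕ} : Fin n ⊕ ℕ → List ℕ
  | Sum.inl i => [0, i]
  | Sum.inr j => [1, j]

/-- The code of a gate of a circuit over `accBasis m` as a list of naturals: its symbolic code
`accCode m`, its arity, then the codes of its argument wires in order (a design choice of this
file; cf. Williams 2014, §3, proof of Lemma 3.1: "the gate type of `j`, as well as the indices
of gates whose outputs are the inputs for gate `j`"). [folklore] -/
def gateCodeList (m : ℕ) {n : ℕ} (g : Gate (Fin n)) : List ℕ :=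
  accCode m g.fn :: g.arity :: (List.ofFn g.args).flatMap wireCode

/-- The code of a circuit on the inputs `Fin n` over `accBasis m` as a list of naturals: the
number `n` of inputs, the output wire, the number of gates, then the gate codes in program
order (self-delimiting thanks to the arity fields; a design choice of this file, cf.
Arora–Barak 2009, §0.1 and Rem. 6.4, straight-line programs as strings). [folklore] -/
def circuitCodeList (m : ℕ) {n : ℕ} (C : Circuit (Fin n)) : List ℕ :=
  n :: wireCode C.output ++ C.size :: C.gates.flatMap (gateCodeList m)

/-- The string encoding of a circuit `C : Circuit (Fin n)` over `accBasis m` handed to an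
`ACC`-CIRCUIT-SAT algorithm: the list `circuitCodeList m C` in the library's binary list
encoding `encodingListNatBool` (Arora–Barak 2009, §0.1; Williams 2014, §3: "given an ACC
circuit `C`"). Its length is `O((n + g + w) log (n + g))` for `g` gates and `w` wires. Only
gates of `accBasis m` are represented faithfully (`GateFn.ofAccCode_accCode`); other gates
receive the code `4` (a design choice of this file). [folklore] -/
def encodeAccCircuit (m : ℕ) {n : ℕ} (C : Circuit (Fin n)) : List Bool :=
  encodingListNatBool.encode (circuitCodeList m C)

/-! ### The encoding is lossless on circuits over `accBasis m` -/

/-- Wire codes have length two. [folklore] -/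
@[simp] theorem length_wireCode {n : ℕ} (w : Fin n ⊕ ℕ) : (wireCode w).length = 2 := by
  cases w <;> rfl

/-- `wireCode` is injective. [folklore] -/
theorem wireCode_injective {n : ℕ} : Function.Injective (wireCode (n := n)) := by
  rintro (i | j) (i' | j') h <;> simp only [wireCode, List.cons.injEq, and_true] at h
  · exact congrArg Sum.inl (Fin.ext h.2)
  · exact absurd h.1 zero_ne_one
  · exact absurd h.1 one_ne_zero
  · rw [h.2]

/-- Concatenated wire codes determine the list of wires. [folklore] -/
theorem flatMap_wireCode_injective {n : ℕ} :
    Function.Injective fun l : List (Fin n ⊕ ℕ) => l.flatMap wireCode := by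
  intro l₁
  induction l₁ with
  | nil =>
    intro l₂ h
    cases l₂ with
    | nil => rfl
    | cons w l₂ => cases w <;> simp [wireCode] at h
  | cons w l₁ ih =>
    intro l₂ h
    cases l₂ with
    | nil => cases w <;> simp [wireCode] at h
    | cons w' l₂ =>
      simp only [List.flatMap_cons] at h
      obtain ⟨h1, h2⟩ := List.append_inj h (by simp)
      rw [wireCode_injective h1, ih h2]

/-- The concatenated gate codes of a program over `accBasis m` determine the program (the code is
self-delimiting: code, arity `k`, then `2k` naturals). [folklore] -/
theorem flatMap_gateCodeList_injOn (m n : ℕ) :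
    ∀ gs₁ gs₂ : List (Gate (Fin n)), (∀ g ∈ gs₁, g.fn ∈ accBasis m) →
      (∀ g ∈ gs₂, g.fn ∈ accBasis m) →
      gs₁.flatMap (gateCodeList m) = gs₂.flatMap (gateCodeList m) → gs₁ = gs₂ := by
  intro gs₁
  induction gs₁ with
  | nil =>
    intro gs₂ _ _ h
    cases gs₂ with
    | nil => rfl
    | cons g gs₂ => simp [gateCodeList] at h
  | cons g₁ gs₁ ih =>
    intro gs₂ h₁ h₂ h
    cases gs₂ with
    | nil => simp [gateCodeList] at h
    | cons g₂ gs₂ =>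
      simp only [List.flatMap_cons, gateCodeList, List.cons_append, List.cons.injEq] at h
      obtain ⟨hcode, harity, hrest⟩ := h
      obtain ⟨k₁, op₁, args₁⟩ := g₁
      obtain ⟨k₂, op₂, args₂⟩ := g₂
      change k₁ = k₂ at harity
      subst harity
      obtain ⟨hargs, htail⟩ :=
        List.append_inj hrest (by simp [List.length_flatMap, Function.comp_def])
      have hargs' : args₁ = args₂ :=
        List.ofFn_injective (flatMap_wireCode_injective hargs)
      subst hargs'
      have hfn₁ := GateFn.ofAccCode_accCode (h₁ _ (List.mem_cons_self ..))
      have hfn₂ := GateFn.ofAccCode_accCode (h₂ _ (List.mem_cons_self ..))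
      change GateFn.ofAccCode m (accCode m ⟨k₁, op₁⟩) k₁ = ⟨k₁, op₁⟩ at hfn₁
      change GateFn.ofAccCode m (accCode m ⟨k₁, op₂⟩) k₁ = ⟨k₁, op₂⟩ at hfn₂
      change accCode m ⟨k₁, op₁⟩ = accCode m ⟨k₁, op₂⟩ at hcode
      rw [hcode, hfn₂] at hfn₁
      have hop : op₂ = op₁ := eq_of_heq (Sigma.mk.inj_iff.1 hfn₁).2
      subst hop
      rw [ih gs₂ (fun g hg => h₁ g (List.mem_cons_of_mem _ hg))
        (fun g hg => h₂ g (List.mem_cons_of_mem _ hg)) htail]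

/-- **The code of a circuit over `accBasis m` determines the circuit**: `circuitCodeList m` is
injective on circuits over `accBasis m` (so an `ACC`-SAT algorithm receives complete
information). [folklore] -/
theorem circuitCodeList_injOn (m n : ℕ) :
    Set.InjOn (circuitCodeList m (n := n)) {C | C.IsOver (accBasis m)} := by
  intro C₁ h₁ C₂ h₂ h
  simp only [circuitCodeList] at h
  obtain ⟨hhead, htail⟩ := List.append_inj h (by simp)
  simp only [List.cons.injEq, true_and] at hhead htail
  have hout := wireCode_injective hhead
  have hgates := flatMap_gateCodeList_injOn m n C₁.gates C₂.gates h₁ h₂ htail.2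
  obtain ⟨gs₁, o₁, _, _⟩ := C₁
  obtain ⟨gs₂, o₂, _, _⟩ := C₂
  simp only at hout hgates
  subst hout; subst hgates
  rfl

/-- The string encoding `encodeAccCircuit m` is injective on circuits over `accBasis m`.
[folklore] -/
theorem encodeAccCircuit_injOn (m n : ℕ) :
    Set.InjOn (encodeAccCircuit m (n := n)) {C | C.IsOver (accBasis m)} :=
  fun _ h₁ _ h₂ h => circuitCodeList_injOn m n h₁ h₂ (encodingListNatBool.encode_injective h)

/-! ### Satisfiability algorithms for `AC⁰[m]` circuits with a time bound -/

/-- `AccSatInTime d m s T`: *satisfiability of depth-`d` `AC⁰[m]` circuits of size `s` is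
decidable in deterministic time `O(T n)`*, `n` the number of inputs. Precisely: there are a
constant `c` and a TM2 machine `M` (Mathlib's multi-stack model, input and output alphabet
`Bool`) such that for every `n` and every circuit `C : Circuit (Fin n)` over `accBasis m` with
`acDepth C ≤ d`, at most `s n` gates and fan-in at most `s n`, `M` started on
`encodeAccCircuit m C` halts within `c * T n + c` steps with output `encodeBool b`, where
`b = true` iff `C` is satisfiable (the hypothesis format of Williams 2014, Thm. 1.3 /
Thm. 3.2: "satisfiability of `C`-circuits with `n` variables and `n ^ c` size can be solved in
`O(2ⁿ/nᵏ)` time"; size in gates and fan-in, see the module docstring). No requirement is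
imposed on other inputs. [cite: Williams2014, §3 and Thm. 1.3] -/
def AccSatInTime (d m : ℕ) (s T : ℕ → ℕ) : Prop :=
  ∃ (c : ℕ) (M : TM2ComputableAux Bool Bool),
    ∀ (n : ℕ) (C : Circuit (Fin n)), C.IsOver (accBasis m) → C.acDepth ≤ d → C.size ≤ s n →
      C.maxFanIn ≤ s n →
        M.OutputsWithin (encodeAccCircuit m C)
          (encodeBool (decide C.Satisfiable)) (c * T n + c)

/-- Monotonicity of `AccSatInTime` in the time bound up to the `O`-constant: if `T n ≤ T' n` for
`n ≥ N` and `T` is bounded by `B` below `N`, an `O(T)` algorithm is an `O(T')` algorithm (the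
finitely many small input lengths are absorbed by the additive constant). [folklore] -/
theorem AccSatInTime.of_le_of_bdd {d m : ℕ} {s T T' : ℕ → ℕ} (h : AccSatInTime d m s T)
    (N B : ℕ) (hle : ∀ n, N ≤ n → T n ≤ T' n) (hB : ∀ n, n < N → T n ≤ B) :
    AccSatInTime d m s T' := by
  obtain ⟨c, M, hM⟩ := h
  refine ⟨c * B + c, M, fun n C hO hd hs hf => (hM n C hO hd hs hf).mono ?_⟩
  rcases lt_or_ge n N with hn | hn
  · calc c * T n + c ≤ c * B + c := Nat.add_le_add_right (Nat.mul_le_mul_left c (hB n hn)) c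
      _ ≤ (c * B + c) * T' n + (c * B + c) := Nat.le_add_left _ _
  · calc c * T n + c ≤ c * T' n + c := Nat.add_le_add_right (Nat.mul_le_mul_left c (hle n hn)) c
      _ ≤ (c * B + c) * T' n + (c * B + c) :=
          Nat.add_le_add (Nat.mul_le_mul_right _ (Nat.le_add_left _ _)) (Nat.le_add_left _ _)

/-- Monotonicity of `AccSatInTime` in the size bound (fewer instances). [folklore] -/
theorem AccSatInTime.anti_size {d m : ℕ} {s s' T : ℕ → ℕ} (h : AccSatInTime d m s T)
    (hs : ∀ n, s' n ≤ s n) : AccSatInTime d m s' T := by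
  obtain ⟨c, M, hM⟩ := h
  exact ⟨c, M, fun n C hO hd hsz hf => hM n C hO hd (hsz.trans (hs n)) (hf.trans (hs n))⟩

/-! ### Two ingredients of Theorem 1.3 (vendored for the further decomposition) -/

/-- **Nondeterministic time hierarchy theorem** (Cook 1972; Seiferas–Fischer–Meyer 1978;
Žák 1983; Arora–Barak 2009, Thm. 3.2: "If `f, g` are time constructible functions satisfying
`f(n + 1) = o(g(n))`, then `NTIME(f(n)) ⊊ NTIME(g(n))`"). Vendored as the NON-CONTAINMENT
`¬ (NTIME g ⊆ NTIME f)`, which is the content of the printed strict inclusion used in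
Williams' argument (Williams 2014, p. 4 and proofs of Thm. 3.2 / Thm. 1.1: a simulation
`NTIME[2ⁿ] ⊆ NTIME[2ⁿ/nᵏ]` "contradicts the nondeterministic time hierarchy theorem
[SFM78, Zak83]"); the accompanying inclusion `NTIME f ⊆ NTIME g` is not asserted (it needs
`f ≤ g` eventually, cf. `NTIME_mono`). `IsTimeConstructible` is Arora–Barak's notion
(`t n ≥ n`, `1ⁿ ↦ bin (t n)` in `O(t n)`), `o(·)` is Mathlib's `IsLittleO` along `atTop`, and
`NTIME` is the library's verifier form over TM2, which for `t n ≥ n` agrees with multitape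
nondeterministic time up to the constant factors of its `O`-form (guess the certificate, then
verify; Williams 2014, §2 "On the machine model", Thm. 2.1). [cite: AroraBarak2009, Thm. 3.2] -/
def ntime_hierarchy : Prop :=
  ∀ (f g : ℕ → ℕ), IsTimeConstructible f → IsTimeConstructible g →
    ((fun n => (f (n + 1) : ℝ)) =o[atTop] fun n => (g n : ℝ)) → ¬ (NTIME g ⊆ NTIME f)

/-- **`P` in `ACC` puts every polynomial-size circuit family in `ACC`** (Williams 2014,
Lemma 5.1 (folklore), the case of polynomial `S`, `T` and `C = ACC`: "If `P` has non-uniform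
`C` circuits of `S(n)^{O(1)}` size, then there is a `c > 0` such that every `T(n)`-size circuit
family (uniform or not) has an equivalent `S(n + O(T(n) log T(n)))ᶜ`-size circuit family in
`C`", proved via the `C`-circuits of the CIRCUIT-EVAL problem; "if `S(n)` and `T(n)` are
polynomials, then `S(n + O(T(n) log T(n)))ᶜ` is also polynomial"). At the level of languages
(a family of Boolean functions `(Fin n → Bool) → Bool` is the family of slices of a language and
conversely): `P ⊆ ACC0 → P/poly ⊆ ACC0`. Proved below
(`Williams2014_PPoly_subset_ACC0_of_P_subset_holds`). [cite: Williams2014, Lemma 5.1] -/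
def Williams2014_PPoly_subset_ACC0_of_P_subset : Prop :=
  Classes.P ⊆ ACC0 → PPoly ⊆ ACC0

end Literature.Computability.Complexity

namespace Literature.Computability.Complexity

open Classes

/-! ### Williams 2014, Thm. 1.3 (for `ACC`) and Thm. 4.1 as named facts -/

/-- **Williams' algorithms-to-lower-bounds transfer for `ACC`** (Williams 2014, Thm. 1.3,
specialised to the circuit class `C = ACC`; proved there from Lemma 3.1, Thm. 3.2, Lemma 5.1,
Thm. 5.2 (Impagliazzo–Kabanets–Wigderson) and the nondeterministic time hierarchy, see the
proof of Thm. 1.1, p. 17–18). Printed: "There is a `k > 0` such that, if satisfiability of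
`C`-circuits with `n` variables and `n ^ c` size can be solved in `O(2ⁿ/nᵏ)` time for every `c`,
then `NTIME[2ⁿ]` doesn't have non-uniform polysize `C`-circuits." Here, for `ACC = ⋃ AC⁰_d[m]`,
the assumed algorithm may depend on the depth `d`, the modulus `m ≥ 2` and the exponent `c`
(the form established by the printed proof, which only runs it on circuits of depth
`2 d₀ + O(1)` over one modulus, and the form combined with Thm. 4.1 on p. 18); size `n ^ c + c`
gates of fan-in `≤ n ^ c + c` (`AccSatInTime`); conclusion `NTIME (2 ^ ·) ⊄ ACC0` with the
library's gate-count `ACC0` (Williams, p. 5: wires versus gates "does not matter" for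
polynomially many gates). [cite: Williams2014, Thm. 1.3] -/
def Williams2014_lowerBound_of_accSat : Prop :=
  ∃ k : ℕ, 0 < k ∧
    ((∀ d m c : ℕ, 2 ≤ m →
        AccSatInTime d m (fun n => n ^ c + c) (fun n => 2 ^ n / n ^ k)) →
      ¬ (NTIME (fun n => 2 ^ n) ⊆ ACC0))

/-- **Williams' `ACC` circuit-satisfiability algorithm, polynomial-size form** (Williams 2014,
Thm. 4.1: "For every `d > 1` there is an `ε ∈ (0,1)` such that satisfiability of depth-`d` ACC
circuits with `n` inputs and `2^{n^ε}` size can be determined in `2^{n - Ω(n^δ)}` time for some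
`δ > ε` that depends only on `d`", in the consequence drawn in the proof of Thm. 1.1, p. 18:
"the Circuit SAT algorithm of Theorem 4.1 can determine satisfiability of any `n + c log n`
input, `n ^ c` size ACC circuit in `O(2^{n - log² n})` time, for every constant `c`").
Stated per depth `d` and modulus `m ≥ 2` (the `SYM⁺` conversion of Lemma 4.1 depends on both),
for circuits with at most `n ^ c + c` gates of fan-in `≤ n ^ c + c` (hence `≤ (n ^ c + c)²`
wires), with the time bound `O(2 ^ n / 2 ^ ((log₂ n)²))`, `log₂ = Nat.log 2` (`AccSatInTime`).
This is Thm. 4.1 read at polynomial size: for `n` large, `(n ^ c + c)² ≤ 2^{n^ε}` and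
`2^{n - Ω(n^δ)} ≤ 2ⁿ / 2^{(log₂ n)²}`; for the finitely many smaller `n` there are finitely many
instances, answered by table lookup within the additive constant. [cite: Williams2014, Thm. 4.1 and proof of Thm. 1.1] -/
def Williams2014_accSat_polysize : Prop :=
  ∀ d m c : ℕ, 2 ≤ m →
    AccSatInTime d m (fun n => n ^ c + c) (fun n => 2 ^ n / 2 ^ (Nat.log 2 n) ^ 2)

/-! ### Assembly: Theorem 1.1 from Theorem 1.3 and Theorem 4.1 -/

/-- For `n ≥ 2 ^ (k + 1)` one has `n ^ k ≤ 2 ^ ((log₂ n) ^ 2)`: with `L = log₂ n ≥ k + 1`,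
`n < 2 ^ (L + 1)` and `(L + 1) k ≤ L²`. [folklore] -/
theorem pow_le_two_pow_log_sq {k n : ℕ} (hn : 2 ^ (k + 1) ≤ n) :
    n ^ k ≤ 2 ^ (Nat.log 2 n) ^ 2 := by
  set L := Nat.log 2 n with hL
  have hn0 : n ≠ 0 := by
    intro h; subst h; exact absurd hn (Nat.not_le.mpr (Nat.two_pow_pos _))
  have hkL : k + 1 ≤ L := (Nat.le_log_iff_pow_le one_lt_two hn0).mpr hn
  have hlt : n < 2 ^ (L + 1) := Nat.lt_pow_succ_log_self one_lt_two n
  calc n ^ k ≤ (2 ^ (L + 1)) ^ k := Nat.pow_le_pow_left hlt.le k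
    _ = 2 ^ ((L + 1) * k) := by rw [← pow_mul]
    _ ≤ 2 ^ L ^ 2 := Nat.pow_le_pow_right two_pos (by nlinarith)

/-- Eventually `2 ^ n / 2 ^ ((log₂ n)²) ≤ 2 ^ n / n ^ k`, namely for `n ≥ 2 ^ (k + 1)`.
[folklore] -/
theorem two_pow_div_two_pow_log_sq_le {k n : ℕ} (hn : 2 ^ (k + 1) ≤ n) :
    2 ^ n / 2 ^ (Nat.log 2 n) ^ 2 ≤ 2 ^ n / n ^ k := by
  have hn0 : 0 < n := lt_of_lt_of_le (Nat.two_pow_pos _) hn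
  exact Nat.div_le_div_left (pow_le_two_pow_log_sq hn) (Nat.pow_pos hn0)

/-- An `O(2ⁿ / 2^{(log₂ n)²})` satisfiability algorithm is an `O(2ⁿ / nᵏ)` algorithm for every
`k` (Williams 2014, proof of Thm. 1.1, p. 18: "unsatisfiability of `D` can be determined in
`O(2ⁿ/nᶜ)` time for every constant `c`"). [cite: Williams2014, proof of Thm. 1.1] -/
theorem AccSatInTime.two_pow_div_pow_of_log_sq {d m : ℕ} {s : ℕ → ℕ}
    (h : AccSatInTime d m s (fun n => 2 ^ n / 2 ^ (Nat.log 2 n) ^ 2)) (k : ℕ) :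
    AccSatInTime d m s (fun n => 2 ^ n / n ^ k) :=
  h.of_le_of_bdd (2 ^ (k + 1)) (2 ^ 2 ^ (k + 1))
    (fun _ hn => two_pow_div_two_pow_log_sq_le hn)
    (fun n hn => (Nat.div_le_self (2 ^ n) _).trans (Nat.pow_le_pow_right two_pos hn.le))

/-- **Assembly of Williams' Theorem 1.1 from its printed components**: the transfer theorem
(Thm. 1.3 for `ACC`, `Williams2014_lowerBound_of_accSat`) and the `ACC`-SAT algorithm
(Thm. 4.1 in polynomial-size form, `Williams2014_accSat_polysize`) imply
`williams_acc : ¬ (NTIME (2 ^ ·) ⊆ ACC0)` (Williams 2014, proof of Thm. 1.1, p. 18: the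
algorithm of Thm. 4.1 runs in `O(2ⁿ/nᶜ)` for every `c`, in particular for the `k` of Thm. 1.3).
[cite: Williams2014, Thm. 1.1 and its proof] -/
theorem williams_acc_of_Williams2014 (h13 : Williams2014_lowerBound_of_accSat)
    (h41 : Williams2014_accSat_polysize) : williams_acc := by
  obtain ⟨k, -, hk⟩ := h13
  exact hk fun d m c hm => AccSatInTime.two_pow_div_pow_of_log_sq (h41 d m c hm) k

end Literature.Computability.Complexity

/-! ### Proof of Lemma 5.1 for `ACC`: hard-wiring over a basis with constants -/

namespace Literature.Computability.Complexity

open Finset GateList Polynomial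

namespace GateList

variable {ι ι' : Type*}

/-- **Depths under relocation with rewired inputs.** If the program `gs'` is relocated behind
`pre` with its input `i` fed from the wire `ρ i` of `pre`, and every such wire has depth at most
`K` in `pre`, then gate `m` of `gs'` becomes at most `K` deeper (Vollmer 1999, §1.2: the depth
of a composition is at most the sum of the depths). [cite: Vollmer1999, §1.2] -/
theorem getD_wdepths_append_reloc_le (w : GateFn → ℕ) (pre : List (Gate ι)) (ρ : ι' → ι ⊕ ℕ)
    (hρ : WiresOK pre.length ρ) (K : ℕ) (hK : ∀ i, wireDepthOf (wdepths w pre) (ρ i) ≤ K) :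
    ∀ (gs' : List (Gate ι')) (m : ℕ),
      (wdepths w (pre ++ gs'.map (reloc ρ pre.length))).getD (pre.length + m) 0 ≤
        (wdepths w gs').getD m 0 + K := by
  intro gs'
  induction gs' using List.reverseRecOn with
  | nil =>
    intro m
    rw [List.map_nil, List.append_nil, List.getD_eq_default _ _ (by simp)]
    exact Nat.zero_le _
  | append_singleton gs' g ih =>
    intro m
    rw [List.map_append, List.map_singleton, ← List.append_assoc, wdepths_append_singleton,
      wdepths_append_singleton]
    rcases lt_trichotomy m gs'.length with hm | rfl | hm
    · rw [List.getD_append _ _ _ _ (by simp; omega), List.getD_append _ _ _ _ (by simpa using hm)]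
      exact ih m
    · rw [List.getD_append_right _ _ _ _ (by simp), List.getD_append_right _ _ _ _ (by simp)]
      simp only [length_wdepths, List.length_append, List.length_map, Nat.sub_self,
        List.getD_cons_zero, reloc_fn]
      rw [Nat.add_assoc]
      refine Nat.add_le_add_left (Finset.sup_le fun a _ => ?_) _
      refine le_trans ?_ (Nat.add_le_add_right
        (Finset.le_sup (f := fun a => wireDepthOf (wdepths w gs') (g.args a)) (mem_univ a)) K)
      show wireDepthOf _ (shiftWire ρ pre.length (g.args a)) ≤
        wireDepthOf (wdepths w gs') (g.args a) + K
      cases g.args a with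
      | inl i =>
        simp only [shiftWire, wireDepthOf_inl, zero_add]
        rw [wireDepthOf_wdepths_append w pre _ (ρ i) (hρ i)]
        exact hK i
      | inr m' =>
        simp only [shiftWire, wireDepthOf_inr]
        rw [Nat.add_comm m' pre.length]
        exact ih m'
    · rw [List.getD_eq_default _ _ (by simp; omega)]
      exact Nat.zero_le _

end GateList

/-- **Hard-wiring inputs to constants** over any basis containing the constant gates
`∨₀ = 0` and `∧₀ = 1`: re-addressing every input variable of `C` either to a new input variable
or to a constant (`σ`) yields a circuit over the same basis with at most two more gates (the two
constants, placed first) and `acDepth` at most one more, computing `C` on the re-addressed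
assignment (Williams 2014, proof of Lemma 5.1: "define `C'_{|x|}(x) = D_{n₁}(C_{|x|}, x)`";
Arora–Barak 2009, proof of Thm. 6.18, hard-wiring the advice; Vollmer 1999, §1.2).
[cite: Williams2014, Lemma 5.1] -/
theorem Circuit.exists_hardwire {ι ι' : Type*} {B : Set GateFn} (hF : GateFn.or 0 ∈ B)
    (hT : GateFn.and 0 ∈ B) (C : Circuit ι') (hC : C.IsOver B) (σ : ι' → ι ⊕ Bool) :
    ∃ D : Circuit ι, D.IsOver B ∧ D.size ≤ C.size + 2 ∧ D.acDepth ≤ C.acDepth + 1 ∧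
      ∀ x, D.eval x = C.eval (fun j => Sum.elim x id (σ j)) := by
  classical
  let pre : List (Gate ι) := [constGate false, constGate true]
  let ρ : ι' → ι ⊕ ℕ := fun j => Sum.elim Sum.inl (fun b => Sum.inr (cond b 1 0)) (σ j)
  have hρ : WiresOK pre.length ρ := by
    intro j m hj
    simp only [ρ] at hj
    cases hσ : σ j with
    | inl i => rw [hσ] at hj; cases hj
    | inr b =>
      rw [hσ] at hj
      simp only [Sum.elim_inr, Sum.inr.injEq] at hj
      subst hj
      cases b <;> simp [pre]
  have hwfpre : WF pre := by
    intro j g hj a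
    have : g ∈ pre := List.mem_of_getElem? hj
    simp only [pre, List.mem_cons, List.not_mem_nil, or_false] at this
    rcases this with rfl | rfl <;> exact a.elim0
  let gs : List (Gate ι) := pre ++ C.gates.map (reloc ρ pre.length)
  have hwf : WF gs := hwfpre.append_reloc (wf_gates C) hρ
  let o : ι ⊕ ℕ := shiftWire ρ pre.length C.output
  have ho : OutOK gs.length o := by
    intro m hm
    simp only [o] at hm
    cases hout : C.output with
    | inl j =>
      rw [hout] at hm
      exact (hρ j m hm).trans_le (by simp [gs])
    | inr m' =>
      rw [hout] at hm
      simp only [shiftWire, Sum.inr.injEq] at hm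
      have := C.wf_output m' hout
      simp only [gs, List.length_append, List.length_map]
      change m' < C.size at this
      simp only [Circuit.size] at this
      omega
  have hvpre : ∀ x : ι → Bool, vals pre x = [false, true] := fun x => rfl
  have hdpre : wdepths acWeight pre = [1, 1] := by
    simp [pre, wdepths, constGate_fn]
    exact ⟨fun i => i.elim0, fun i => i.elim0⟩
  have hK : ∀ i, wireDepthOf (wdepths acWeight pre) (ρ i) ≤ 1 := by
    intro i
    rw [hdpre]
    cases hσ : σ i with
    | inl i' => simp [ρ, hσ]
    | inr b => cases b <;> simp [ρ, hσ]
  refine ⟨toCircuit gs o hwf ho, ?_, ?_, ?_, ?_⟩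
  · intro g hg
    change g ∈ gs at hg
    simp only [gs, pre, List.cons_append, List.nil_append, List.mem_cons, List.mem_map] at hg
    rcases hg with rfl | rfl | ⟨g', hg', rfl⟩
    · rw [constGate_fn, GateFn.const_false_eq_or_zero]; exact hF
    · rw [constGate_fn, GateFn.const_true_eq_and_zero]; exact hT
    · rw [reloc_fn]; exact hC g' hg'
  · change gs.length ≤ C.size + 2
    simp only [gs, pre, Circuit.size, List.length_append, List.length_cons, List.length_nil,
      List.length_map]
    omega
  · change Circuit.depthWith _ acWeight ≤ _
    rw [circuit_depthWith]
    change wireDepthOf (wdepths acWeight gs) o ≤ C.acDepth + 1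
    have hCd : C.acDepth = wireDepthOf (wdepths acWeight C.gates) C.output :=
      circuit_depthWith C acWeight
    have key := getD_wdepths_append_reloc_le acWeight pre ρ hρ 1 hK C.gates
    simp only [o, gs]
    cases hout : C.output with
    | inl j =>
      simp only [shiftWire]
      rw [wireDepthOf_wdepths_append acWeight pre _ (ρ j) (hρ j)]
      exact (hK j).trans (Nat.le_add_left 1 _)
    | inr m =>
      simp only [shiftWire, wireDepthOf_inr]
      rw [hCd, hout, wireDepthOf_inr, Nat.add_comm m]
      exact key m
  · intro x
    rw [circuit_eval, circuit_eval C]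
    change wireOf x (vals gs x) o = _
    simp only [gs, o]
    rw [vals_append_reloc pre C.gates ρ hρ x,
      wireOf_shiftWire x (vals pre x) _ (length_vals pre x) ρ hρ C.output]
    have hassign : (fun i => wireOf x (vals pre x) (ρ i)) = fun j => Sum.elim x id (σ j) := by
      funext j
      simp only [ρ, hvpre]
      cases σ j with
      | inl i => rfl
      | inr b => cases b <;> rfl
    rw [hassign]

/-- **Discharge of `Williams2014_PPoly_subset_ACC0_of_P_subset`** (Williams 2014, Lemma 5.1
for `ACC` and polynomial bounds): if `P ⊆ ACC⁰` then `P/poly ⊆ ACC⁰`. Proof: `P/poly = P/poly`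
with advice (`PPoly_eq_polyAdvice_P_holds`, Arora–Barak 2009, Thm. 6.18, whose substantial
direction is the polynomial-time circuit evaluator — Williams' CIRCUIT-EVAL argument); the
witness language `L' ∈ P ⊆ ACC⁰` has depth-`d`, size-`q` `AC⁰[m]` circuits on the paired
inputs `⟨x, a(|x|)⟩` of length `2n + 2 + |a(n)|`, and hard-wiring the advice
(`Circuit.exists_hardwire` along the addressing `pairVec`) gives depth-`(d + 1)`,
size-`(q(2n + 2 + p(n)) + 2)` `AC⁰[m]` circuits for `L`. [cite: Williams2014, Lemma 5.1] -/
theorem Williams2014_PPoly_subset_ACC0_of_P_subset_holds :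
    Williams2014_PPoly_subset_ACC0_of_P_subset := by
  classical
  intro hP L hL
  rw [PPoly_eq_polyAdvice_P_holds] at hL
  obtain ⟨L', hL'P, a, p, hp, hLa⟩ := hL
  have hL'ACC : L' ∈ ACC0 := hP hL'P
  simp only [ACC0, Set.mem_iUnion] at hL'ACC
  obtain ⟨m, hm, d, q, C, hC, hdec⟩ := hL'ACC
  simp only [ACC0, Set.mem_iUnion]
  refine ⟨m, hm, ?_⟩
  have hqmono : ∀ {x y : ℕ}, x ≤ y → q.eval x ≤ q.eval y := fun h => Literature.Computability.Complexity.natPoly_eval_mono q h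
  let Np : Polynomial ℕ := 2 * X + 2 + p
  let r : Polynomial ℕ := q.comp Np + 2
  have hr : ∀ n, r.eval n = q.eval (2 * n + 2 + p.eval n) + 2 := by
    intro n
    simp [r, Np, eval_comp]
  have main : ∀ n : ℕ, ∃ D : Circuit (Fin n), D.IsOver (accBasis m) ∧ D.acDepth ≤ d + 1 ∧
      D.size ≤ r.eval n ∧ ∀ u : Fin n → Bool, D.eval u = L.boolIndicator (List.ofFn u) := by
    intro n
    let σ : Fin (2 * n + 2 + (a n).length) → Fin n ⊕ Bool :=
      Fin.append (Fin.append (fun i : Fin (2 * n) => Sum.inl ⟨(i : ℕ) / 2, by have := i.2; omega⟩)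
        ![Sum.inr false, Sum.inr true]) (fun j => Sum.inr ((a n).get j))
    obtain ⟨D, hDB, hDs, hDd, hDe⟩ := Circuit.exists_hardwire (B := accBasis m)
      (acBasis_subset_accBasis m (or_mem_acBasis 0)) (acBasis_subset_accBasis m (and_mem_acBasis 0))
      (C (2 * n + 2 + (a n).length)) (hC _).1 σ
    refine ⟨D, hDB, hDd.trans (Nat.add_le_add_right (hC (2 * n + 2 + (a n).length)).2.1 1),
      hDs.trans ?_, fun u => ?_⟩
    · rw [hr n]
      have h1 : 2 * n + 2 + (a n).length ≤ 2 * n + 2 + p.eval n := by have := hp n; omega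
      have h2 := hqmono h1
      have h3 : (C (2 * n + 2 + (a n).length)).size ≤ q.eval (2 * n + 2 + (a n).length) :=
        (hC (2 * n + 2 + (a n).length)).2.2
      omega
    · rw [hDe u]
      have hσ : (fun j => Sum.elim u id (σ j)) = pairVec u (a n).get := by
        funext j
        refine Fin.addCases (fun j₁ => ?_) (fun j₂ => ?_) j
        · refine Fin.addCases (fun i => ?_) (fun t => ?_) j₁
          · simp [σ, pairVec, Fin.append_left]
          · simp only [σ, pairVec, Fin.append_left, Fin.append_right]
            fin_cases t <;> rfl
        · simp [σ, pairVec, Fin.append_right]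
      rw [hσ, hdec.eval_eq, ofFn_pairVec, List.ofFn_get]
      exact (boolIndicator_eq_of_iff ((hLa (List.ofFn u)).trans (by rw [List.length_ofFn]))).symm
  choose D hD using main
  exact ⟨d + 1, r, D, fun n => ⟨(hD n).1, (hD n).2.1, (hD n).2.2.1⟩, fun x => by
    have := (hD x.length).2.2.2 x.get
    rwa [List.ofFn_get] at this⟩

end Literature.Computability.Complexity
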